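import Literature.NumberTheory.Automorphic.VarmaTheorem92Engine
import Literature.NumberTheory.Automorphic.ReciprocityGLnExistenceProofs
import HarnessLib

/-!
# Varma 2024, (9.1): Thm. 9.2 in trace form, PROVED from the `2n`-dimensional `R_{p,ı}(π, M)`
# (Thm. 5.1 + Prop. 7.1, with HLTT Cor. 6.27) by Prop. 9.1

Topic `Literature/NumberTheory/Automorphic`; a PROOFS file (theorems only: no definition, no named
fact — D-0014/D-0026), on top of `VarmaTheorem92Engine` (the group theory) and
`ReciprocityGLnExistenceProofs` (the discharged leaves `prop712Hausdorff_holds`,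
`chebotarev_artinRep_holds`, and HLTT's bad-places bookkeeping).  It formalises the first half of
the printed proof of Varma's Thm. 9.2 — up to and including display (9.1) — for the places where
`π` is unramified, in the trace vocabulary of `Varma2024.theorem1_unramified_traces`.

I. Varma, *Local–global compatibility for regular algebraic cuspidal automorphic representations
when `ℓ ≠ p`*, Forum Math. Sigma 12 (2024) e21, doi:10.1017/fms.2024.7.  The source, read (journal
PDF; arXiv:1411.2520v1 for the TeX of the proof, whose numbering is Prop. 9.1 ↔ journal Prop. 7.1,
Prop. 10.1 ↔ Prop. 9.1, Thm. 10.2 ↔ Thm. 9.2):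

* **Prop. 7.1** (journal p. 20): "Let `ρ` be an algebraic representation of `L_{(n)}` over
  `ℤ_{(p)}`. Suppose that `Π` is an irreducible quotient of an admissible
  `G(𝔸^∞)^{ord,×}`-submodule `Π'` of `H⁰(𝔛^{ord,min}, ℰ^{ord,sub}_ρ) ⊗ ℚ̄_p`. Then there is a
  continuous semisimple representation `R_p(Π) : G_F → GL_{2n}(ℚ̄_p)` with the following property:
  If `ℓ ≠ p` is a rational prime such that either `ℓ` splits in `F₀`, or both `F` and `Π` are
  unramified above `ℓ`, and `v ∣ ℓ` is a prime of `F`, then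
  `WD(R_p(Π)|_{G_{F_v}})^{ss} ≅ rec_{F_v}(BC(Π_ℓ)_v |det|^{(1-2n)/2})^{ss}`."
* **Thm. 5.1** (= arXiv Thm. 6.1: "Combine Corollary 1.13, Corollary 6.12, Corollary 6.17,
  Lemma 6.20, and Corollary 6.25 in [HLTT]"): for `N` large the irreducible subquotients of
  `Ind(π^∞‖det‖^N × ψ^∞)` occur in the space of ordinary `p`-adic automorphic forms on `U(n,n)`.
* **Proof of Thm. 9.2** (journal p. 31 = arXiv p. 24): "`Γ = G_{F,S}`, `k = ℚ̄_p`, `μ = ε_p^{-2}`,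
  `ℳ` = all sufficiently large `m`, `ρ_m = R_{p,ı}(π, m) = R_p(ı⁻¹Ind(π^∞‖det‖^m × 1)) ⊗ ε_p^{-m}`
  … Let `𝔉` contain all elements `σ_v ∈ W_{F_v}` which project to a power of Frobenius … `𝓔¹_{σ_v}`
  = the roots of the characteristic polynomial of `ı⁻¹rec_{F_v}(π_v|det|_v^{(1-n)/2})(σ_v)`, `𝓔²_{σ_v}`
  = those of `ı⁻¹rec_{F_{ᶜv}}(π_{ᶜv}|det|^{(-1+3n)/2})(σ_{ᶜv}⁻¹)`. We can then conclude
  **(9.1)** `(r_{p,ı}(π)|_{W_{F_v}})^{ss} ≅ ı⁻¹rec_{F_v}(π_v|det|_v^{(1-n)/2})^{ss}`."  (The second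
  half of the proof — the `≺`-statement via Cor. 8.12, Schneider–Zink types and a twisting
  argument — concerns Thm. 2 and is not needed for the trace statement.)

## What is proved

* `Varma2024.trace_eq_card_of_forall_trace_mul_pow` — **degree `0` from the positive degrees**:
  for `A ∈ GL_m(F)`, `B ∈ M_m(F)` and a multiset `b` of non-zero scalars, if
  `tr (B A^d) = ∑_{c ∈ b} c^d` for all `d ≥ 1` then `tr B = #b` (linear recurrence with
  characteristic polynomial `charpoly(A)·∏(X - c)`, whose constant term is non-zero).  This is
  the step "the elements of Frobenius degree `0` (inertia)" of (9.1), which Prop. 9.1 does not see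
  (`μ` has finite order there).
* `Varma2024.theorem92_traces_of_prop71` — **(9.1), i.e. Thm. 9.2 in trace form, from the
  `2n`-dimensional input, PROVED**.  The input is ONE raw hypothesis `h57` (no named fact is
  introduced): for `K` CM ⊇ `F₀` imaginary quadratic with `p` split in `F₀`, `n ≥ 2` (`n > 2` if
  `[K:ℚ] = 2`), `π` cuspidal with `π_∞` regular algebraic, a family `R_N` (`N ≥ N₀`) of continuous
  semisimple `Γ_K → GL_{2n}(ℚ̄_p)` with (a) HLTT's Cor. 6.27 conclusion (the tree's
  `corollary627_splitOrUnramified`, verbatim, for the same family: `R_N` unramified with the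
  displayed Frobenius characteristic polynomial at the places over `q ≠ p` split in `F₀` or
  unramified in `K`, above which `π` is unramified) and (b) Varma's Thm. 5.1 + Prop. 7.1 at the
  places `v` over `q ≠ p` SPLIT in `F₀` with `π_v` unramified — NO condition on `π` at the other
  places over `q` —: at every element of `Γ_K` of non-zero Frobenius degree `d` at `𝔓 ∣ v`
  (`σ (φ^d)⁻¹ ∈ I_𝔓`), the roots of `charpoly R_N(σ)` are `{b_j^d} ⊔ 𝓔²_σ · q_v^{-2dN}`, `b_j` the
  roots of `arithFrobPolyOfSatake ı q_v n α` (= `𝓔¹`, the eigenvalues of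
  `ı⁻¹rec(π_v|det|^{(1-n)/2})` at an unramified `π_v`, in the tree's normalisation) and `𝓔²` SOME
  `n`-element multiset of non-zero scalars (existential — weaker than the printed second summand).
  Output: `r` continuous semisimple with (i) `IsGaloisCompatibleAt π ı r v` at the places of (a)
  [= HLTT Thm. 7.13] and (ii) `tr r(σ) = ∑_j b_j^d` for EVERY `σ` of Frobenius degree `d ∈ ℤ` at a
  prime over a place of (b) [= (9.1) at unramified `π_v`, read on traces].

The sibling `VarmaTheorem1BaseChangeProofs` (to follow) runs Cor. 9.3's base-change/descent
(Harris–Taylor VII.1.9, as in `VarmaCorollary93BaseChangeProofs`) in trace form, giving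
`Varma2024.theorem1_unramified_traces` from `h57` and the two Arthur–Clozel leaves.

## References

* I. Varma, Forum Math. Sigma 12 (2024) e21: Thm. 5.1, Prop. 7.1 (p. 20), Prop. 9.1, Thm. 9.2 and
  its proof with (9.1) (pp. 30–31); = arXiv:1411.2520v1 Thm. 6.1 (p. 14), Prop. 9.1 (p. 17),
  Prop. 10.1 and proof of Thm. 10.2 (p. 24). [VarmaFMS2024]
* M. Harris, K.-W. Lan, R. Taylor, J. Thorne, Res. Math. Sci. 3:37 (2016): Cor. 6.27 (p. 225),
  Cor. 7.3, Prop. 7.12, Thm. 7.13 (p. 232). [HarrisLanTaylorThorneRMS2016]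
-/

noncomputable section

open scoped MatrixGroups Matrix Classical Polynomial NumberField
open NumberField IsDedekindDomain Field Polynomial Literature.NumberTheory.Automorphic

namespace Literature.NumberTheory.Automorphic

namespace Varma2024

open Literature.NumberTheory.GaloisRepresentations
open Literature.NumberTheory.Automorphic.HarrisLanTaylorThorne2016

/-! ### Degree `0` from the positive degrees: a linear recurrence -/

section Recurrence

variable {F : Type*} [Field F] {m : Type*} [Fintype m] [DecidableEq m]

/-- **The value at `0` of an exponential sum is forced by its values at `d ≥ 1`.**  Let
`A ∈ GL_m(F)`, `B ∈ M_m(F)` and `b` a multiset of NON-ZERO scalars.  If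
`tr (B A^d) = ∑_{c ∈ b} c^d` for all `d ≥ 1`, then also `tr B = #b` (the case `d = 0`).  Proof:
both `d ↦ tr (B A^d)` and `d ↦ ∑ c^d` satisfy the linear recurrence with characteristic polynomial
`χ = charpoly(A) · ∏_{c ∈ b} (X - c)` (Cayley–Hamilton; `χ(c) = 0`), whose constant coefficient
`χ(0) = ± det A · ∏ (-c)` is non-zero; the recurrence at `d = 0` then gives the value at `0`.
(This is how the trace identity of Varma's (9.1) on the inertia subgroup — Frobenius degree `0` —
follows from the identity on the elements of positive degree.) [folklore] -/
theorem trace_eq_card_of_forall_trace_mul_pow (A : GL m F) (B : Matrix m m F) (b : Multiset F)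
    (hb : (0 : F) ∉ b)
    (h : ∀ d : ℕ, 1 ≤ d → (B * (A : Matrix m m F) ^ d).trace = (b.map (· ^ d)).sum) :
    B.trace = (Multiset.card b : F) := by
  set χ : F[X] := (A : Matrix m m F).charpoly * (b.map fun c ↦ X - C c).prod with hχ
  -- (1) `∑_k χ_k tr(B A^k) = tr (B χ(A)) = 0`
  have h1 : ∑ k ∈ Finset.range (χ.natDegree + 1),
      χ.coeff k * (B * (A : Matrix m m F) ^ k).trace = 0 := by
    have hA : aeval (A : Matrix m m F) χ = 0 := by
      rw [hχ, map_mul, Matrix.aeval_self_charpoly, zero_mul]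
    have : B * aeval (A : Matrix m m F) χ = ∑ k ∈ Finset.range (χ.natDegree + 1),
        χ.coeff k • (B * (A : Matrix m m F) ^ k) := by
      rw [aeval_eq_sum_range, Finset.mul_sum]
      refine Finset.sum_congr rfl fun k _ ↦ ?_
      rw [Matrix.mul_smul]
    have ht := congrArg Matrix.trace this
    rw [hA, Matrix.mul_zero, Matrix.trace_zero, Matrix.trace_sum] at ht
    rw [ht]
    refine Finset.sum_congr rfl fun k _ ↦ ?_
    rw [Matrix.trace_smul, smul_eq_mul]
  -- (2) `∑_k χ_k (∑_c c^k) = ∑_c χ(c) = 0`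
  have h2 : ∑ k ∈ Finset.range (χ.natDegree + 1), χ.coeff k * (b.map (· ^ k)).sum = 0 := by
    have hroot : ∀ c ∈ b, χ.eval c = 0 := by
      intro c hc
      rw [hχ, eval_mul, eval_multiset_prod]
      apply mul_eq_zero_of_right
      rw [Multiset.prod_eq_zero_iff]
      exact Multiset.mem_map.mpr ⟨X - C c, Multiset.mem_map.mpr ⟨c, hc, rfl⟩, by simp⟩
    have hsum : (b.map fun c ↦ χ.eval c).sum = 0 := by
      rw [Multiset.map_congr rfl hroot, Multiset.map_const', Multiset.sum_replicate, smul_zero]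
    rw [← hsum]
    have : ∀ c : F, χ.eval c = ∑ k ∈ Finset.range (χ.natDegree + 1), χ.coeff k * c ^ k :=
      fun c ↦ eval_eq_sum_range c
    simp_rw [this, Finset.sum_eq_multiset_sum]
    rw [Multiset.sum_map_sum_map]
    refine congrArg _ (Multiset.map_congr rfl fun k _ ↦ ?_)
    rw [Multiset.sum_map_mul_left]
  -- (3) subtract and isolate `k = 0`
  rw [Finset.sum_range_succ'] at h1 h2
  have htail : ∑ k ∈ Finset.range χ.natDegree,
        χ.coeff (k + 1) * (B * (A : Matrix m m F) ^ (k + 1)).trace =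
      ∑ k ∈ Finset.range χ.natDegree, χ.coeff (k + 1) * (b.map (· ^ (k + 1))).sum :=
    Finset.sum_congr rfl fun k _ ↦ by rw [h (k + 1) (Nat.succ_pos k)]
  rw [htail] at h1
  have hkey : χ.coeff 0 * (B * (A : Matrix m m F) ^ 0).trace =
      χ.coeff 0 * (b.map (· ^ 0)).sum := by
    linear_combination h1 - h2
  rw [pow_zero, Matrix.mul_one] at hkey
  have hc0 : χ.coeff 0 ≠ 0 := by
    rw [coeff_zero_eq_eval_zero, hχ, eval_mul, eval_multiset_prod, Multiset.map_map]
    refine mul_ne_zero ?_ ?_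
    · rw [← coeff_zero_eq_eval_zero]
      intro h0
      have hdet : (A : Matrix m m F).det = 0 := by
        rw [Matrix.det_eq_sign_charpoly_coeff, h0, mul_zero]
      exact (Matrix.isUnits_det_units A).ne_zero hdet
    · apply Multiset.prod_ne_zero
      intro h0
      obtain ⟨c, hc, hc0⟩ := Multiset.mem_map.mp h0
      apply hb
      have : c = 0 := by simpa using hc0
      rwa [← this]
  have hfin := mul_left_cancel₀ hc0 hkey
  rw [hfin, Multiset.map_congr rfl (fun c _ ↦ pow_zero c), Multiset.map_const',
    Multiset.sum_replicate, nsmul_eq_mul, mul_one]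

end Recurrence

/-! ### Thm. 9.2 in trace form from Thm. 5.1 + Prop. 7.1 (+ HLTT Cor. 6.27) -/

/-- **Varma 2024, (9.1) — Thm. 9.2 in trace form — from the `2n`-dimensional `R_{p,ı}(π, M)`
(Thm. 5.1 + Prop. 7.1, with HLTT's Cor. 6.27), PROVED.**  The hypothesis `h57` is the Shimura-variety
input of Varma's proof of Thm. 9.2 (journal p. 31), for `K` CM containing the imaginary quadratic
`F₀` with `p` split in `F₀`, `n ≥ 2` (`n > 2` if `[K:ℚ] = 2`), `π` cuspidal with `π_∞` regular
algebraic: a family `R_N` (`N ≥ N₀`) of continuous semisimple `Γ_K → GL_{2n}(ℚ̄_p)` such that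
(a) [HLTT Cor. 6.27, `corollary627_splitOrUnramified`'s conclusion, for the same family] at the
places over a rational `q ≠ p` split in `F₀` or unramified in `K`, above which `π` is unramified,
`R_N` is unramified with Frobenius characteristic polynomial
`arithFrobPolyOfSatake ı q_v n α · ∏_{b ∈ B_v}(X - b q_v^{-2N})`; (b) [Varma Thm. 5.1 + Prop. 7.1:
"`WD(R_p(Π)|_{G_{F_v}})^{ss} ≅ rec_{F_v}(BC(Π_ℓ)_v |det|^{(1-2n)/2})^{ss}` if `ℓ` splits in `F₀` …",
at an unramified `π_v`, second summand existential] at the places `v` over a rational `q ≠ p`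
SPLIT in `F₀` at which `π_v` is unramified with Satake parameter `α` — no condition on `π` at the
other places over `q` — for every Frobenius-power element `σ` of non-zero degree `d` at a prime
`𝔓 ∣ v` (`σ (φ^d)⁻¹ ∈ I_𝔓`, `φ` an arithmetic Frobenius at `𝔓`), the roots of `charpoly R_N(σ)`
are `{b_j^d} ⊔ 𝓔²_σ q_v^{-2dN}`, `b_j` the roots of `arithFrobPolyOfSatake ı q_v n α`.
CONCLUSION: a continuous semisimple `r : Γ_K → GL_n(ℚ̄_p)` which is (i) compatible with `π`
(`IsGaloisCompatibleAt`) at every place over a good rational prime of (a) [this is HLTT's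
Thm. 7.13], and (ii) satisfies **(9.1) in trace form** at the places of (b): for every `σ ∈ Γ_K`
of Frobenius degree `d ∈ ℤ` at `𝔓 ∣ v` (ALL degrees, `0` included), `tr r(σ) = ∑_j b_j^d`.
Proof: the engine `theorem92_engine` (Prop. 9.1 = HLTT Prop. 7.12, `prop712Hausdorff_holds`;
Chebotarev, `chebotarev_artinRep_holds`; non-vanishing and almost-everywhere existence of Satake
parameters, `hasSatakeParamAt_ne_zero_holds`, `hasSatakeParamAt_cofinite_holds`) with `S` = the
places not over a good prime of (a) and `T` = the places of (b); traces are sums of characteristic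
roots (`Matrix.trace_eq_sum_roots_charpoly`); the degree `0` follows from the positive degrees by
the linear recurrence `trace_eq_card_of_forall_trace_mul_pow`.
[cite: VarmaFMS2024, Thm. 5.1, Prop. 7.1 (p. 20), Prop. 9.1, Thm. 9.2 and its proof with (9.1) (pp. 30–31)]
[cite: HarrisLanTaylorThorneRMS2016, Cor. 6.27 (p. 225), Prop. 7.12 and proof of Thm. 7.13 (p. 232)] -/
theorem theorem92_traces_of_prop71
    (h57 : ∀ {n : ℕ} {K : Type} [Field K] [NumberField K]
      (hcpt : isCompact_glFiniteIntegralLevel n K) (p : ℕ) [Fact p.Prime], 1 < n → IsCMField K →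
      ∀ (F₀ : IntermediateField ℚ K), Module.finrank ℚ F₀ = 2 ∧ IsTotallyComplex F₀ →
      HasTwoPrimesOver F₀ p → (Module.finrank ℚ K = 2 → 2 < n) →
      ∀ (π : CuspidalAutomorphicRepData n K hcpt), π.1.IsRegularAlgebraic →
      ∀ (ι : PadicAlgCl p ≃+* ℂ),
      ∃ (N₀ : ℕ) (R : ℕ → FramedGaloisRep K (PadicAlgCl p) (2 * n))
        (B : HeightOneSpectrum (𝓞 K) → Multiset (PadicAlgCl p))
        (E₂ : HeightOneSpectrum (𝓞 K) → Ideal (absIntegers (𝓞 K) K) → absoluteGaloisGroup K →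
          ℤ → absoluteGaloisGroup K → Multiset (PadicAlgCl p)),
        (∀ N, N₀ ≤ N → (R N).toGaloisRep.IsSemisimple) ∧
        (∀ v, Multiset.card (B v) = n ∧ (0 : PadicAlgCl p) ∉ B v) ∧
        (∀ v 𝔓 φ d σ, Multiset.card (E₂ v 𝔓 φ d σ) = n ∧ (0 : PadicAlgCl p) ∉ E₂ v 𝔓 φ d σ) ∧
        (∀ q : ℕ, q.Prime → q ≠ p →
          (HasTwoPrimesOver F₀ q ∨ Algebra.IsUnramifiedIn (𝓞 K) (Ideal.span {(q : ℤ)})) →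
          π.1.IsUnramifiedAbove q →
          ∀ v : HeightOneSpectrum (𝓞 K), ((q : ℕ) : 𝓞 K) ∈ v.asIdeal →
          ∀ α : Multiset ℂ, π.1.HasSatakeParamAt v α → ∀ N, N₀ ≤ N →
            (R N).IsUnramifiedAt v ∧
            (R N).HasFrobCharpolyAt v (arithFrobPolyOfSatake ι v.residueCard n α *
              ((B v).map fun b ↦ X - C (b * ((v.residueCard : PadicAlgCl p)⁻¹) ^ (2 * N))).prod)) ∧
        (∀ q : ℕ, q.Prime → q ≠ p → HasTwoPrimesOver F₀ q →
          ∀ v : HeightOneSpectrum (𝓞 K), ((q : ℕ) : 𝓞 K) ∈ v.asIdeal →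
          ∀ α : Multiset ℂ, π.1.HasSatakeParamAt v α →
          ∀ 𝔓 ∈ v.primesAbove, ∀ φ : absoluteGaloisGroup K, IsArithFrobAt (𝓞 K) φ 𝔓 →
          ∀ d : ℤ, d ≠ 0 → ∀ σ : absoluteGaloisGroup K,
            σ * (φ ^ d)⁻¹ ∈ 𝔓.inertia (absoluteGaloisGroup K) → ∀ N, N₀ ≤ N →
            (FramedRep.charpoly (R N) σ).roots =
              (arithFrobPolyOfSatake ι v.residueCard n α).roots.map (· ^ d) +
                (E₂ v 𝔓 φ d σ).map
                  (· * (v.residueCard : PadicAlgCl p) ^ (-(2 * d * (N : ℤ))))))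
    {n : ℕ} {K : Type} [Field K] [NumberField K] (hcpt : isCompact_glFiniteIntegralLevel n K)
    (p : ℕ) [Fact p.Prime] (hn : 1 < n) (hCM : IsCMField K)
    (F₀ : IntermediateField ℚ K) (hF₀ : Module.finrank ℚ F₀ = 2 ∧ IsTotallyComplex F₀)
    (hF₀p : HasTwoPrimesOver F₀ p) (hKn : Module.finrank ℚ K = 2 → 2 < n)
    (π : CuspidalAutomorphicRepData n K hcpt) (hπ : π.1.IsRegularAlgebraic)
    (ι : PadicAlgCl p ≃+* ℂ) :
    ∃ r : FramedGaloisRep K (PadicAlgCl p) n, r.toGaloisRep.IsSemisimple ∧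
      (∀ q : ℕ, q.Prime → q ≠ p →
        (HasTwoPrimesOver F₀ q ∨ Algebra.IsUnramifiedIn (𝓞 K) (Ideal.span {(q : ℤ)})) →
        π.1.IsUnramifiedAbove q →
        ∀ v : HeightOneSpectrum (𝓞 K), ((q : ℕ) : 𝓞 K) ∈ v.asIdeal →
          IsGaloisCompatibleAt π.1 ι r v) ∧
      (∀ q : ℕ, q.Prime → q ≠ p → HasTwoPrimesOver F₀ q →
        ∀ v : HeightOneSpectrum (𝓞 K), ((q : ℕ) : 𝓞 K) ∈ v.asIdeal →
        ∀ α : Multiset ℂ, π.1.HasSatakeParamAt v α →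
        ∀ 𝔓 ∈ v.primesAbove, ∀ φ : absoluteGaloisGroup K, IsArithFrobAt (𝓞 K) φ 𝔓 →
        ∀ (d : ℤ) (σ : absoluteGaloisGroup K), σ * (φ ^ d)⁻¹ ∈ 𝔓.inertia (absoluteGaloisGroup K) →
          ((r σ : GL (Fin n) (PadicAlgCl p)) : Matrix (Fin n) (Fin n) (PadicAlgCl p)).trace =
            (((arithFrobPolyOfSatake ι v.residueCard n α).roots.map fun b ↦ b ^ d).sum)) := by
  obtain ⟨N₀, R, B, E₂, hRss, hB, hE₂, hR, hRT⟩ := h57 hcpt p hn hCM F₀ hF₀ hF₀p hKn π hπ ι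
  have hp : p.Prime := Fact.out
  have hn0 : 0 < n := lt_trans zero_lt_one hn
  -- the good rational primes of (a) and the finite set `S` of the other places
  set S : Set (HeightOneSpectrum (𝓞 K)) := {v | ¬ ∃ q : ℕ, q.Prime ∧ q ≠ p ∧
      (HasTwoPrimesOver F₀ q ∨ Algebra.IsUnramifiedIn (𝓞 K) (Ideal.span {(q : ℤ)})) ∧
      π.1.IsUnramifiedAbove q ∧ ((q : ℕ) : 𝓞 K) ∈ v.asIdeal} with hS_def
  have hSfin : S.Finite :=
    finite_setOf_not_exists_goodPrime_of_imp π.1 π.1.hasSatakeParamAt_cofinite_holds p hp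
      fun _ _ h ↦ Or.inr h
  have hgood : ∀ v ∉ S, ∃ q : ℕ, q.Prime ∧ q ≠ p ∧
      (HasTwoPrimesOver F₀ q ∨ Algebra.IsUnramifiedIn (𝓞 K) (Ideal.span {(q : ℤ)})) ∧
      π.1.IsUnramifiedAbove q ∧ ((q : ℕ) : 𝓞 K) ∈ v.asIdeal := fun v hv ↦ by
    simpa only [hS_def, Set.mem_setOf_eq, not_not] using hv
  have hSp : ∀ v ∉ S, ((p : ℕ) : 𝓞 K) ∉ v.asIdeal := fun v hv ↦ by
    obtain ⟨q, hq, hqp, -, -, hqv⟩ := hgood v hv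
    exact natCast_not_mem_of_natCast_mem hq hp hqp hqv
  have hSat : ∀ v ∉ S, ∃ α : Multiset ℂ, π.1.HasSatakeParamAt v α := fun v hv ↦ by
    obtain ⟨q, -, -, -, hπq, hqv⟩ := hgood v hv
    exact hπq v hqv
  have hRv : ∀ v ∉ S, ∀ N, N₀ ≤ N → (R N).IsUnramifiedAt v ∧
      ∀ α : Multiset ℂ, π.1.HasSatakeParamAt v α →
        (R N).HasFrobCharpolyAt v (arithFrobPolyOfSatake ι v.residueCard n α *
          ((B v).map fun b ↦ X - C (b * ((v.residueCard : PadicAlgCl p)⁻¹) ^ (2 * N))).prod) := by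
    intro v hv N hN
    obtain ⟨q, hq, hqp, hQ, hπq, hqv⟩ := hgood v hv
    obtain ⟨α₀, hα₀⟩ := hπq v hqv
    exact ⟨(hR q hq hqp hQ hπq v hqv α₀ hα₀ N hN).1,
      fun α hα ↦ (hR q hq hqp hQ hπq v hqv α hα N hN).2⟩
  -- the Varma places `T`: over `q ≠ p` split in `F₀`, with `π_v` unramified
  set T : Set (HeightOneSpectrum (𝓞 K)) := {v | ∃ q : ℕ, q.Prime ∧ q ≠ p ∧ HasTwoPrimesOver F₀ q ∧
      ((q : ℕ) : 𝓞 K) ∈ v.asIdeal ∧ ∃ α : Multiset ℂ, π.1.HasSatakeParamAt v α} with hT_def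
  have hTp : ∀ v ∈ T, ((p : ℕ) : 𝓞 K) ∉ v.asIdeal := by
    rintro v ⟨q, hq, hqp, -, hqv, -⟩
    exact natCast_not_mem_of_natCast_mem hq hp hqp hqv
  have hTsat : ∀ v ∈ T, ∃ α : Multiset ℂ, π.1.HasSatakeParamAt v α := by
    rintro v ⟨-, -, -, -, -, hα⟩
    exact hα
  have hRT' : ∀ v ∈ T, ∀ α : Multiset ℂ, π.1.HasSatakeParamAt v α →
      ∀ 𝔓 ∈ v.primesAbove, ∀ φ : absoluteGaloisGroup K, IsArithFrobAt (𝓞 K) φ 𝔓 →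
      ∀ d : ℤ, d ≠ 0 → ∀ σ : absoluteGaloisGroup K,
        σ * (φ ^ d)⁻¹ ∈ 𝔓.inertia (absoluteGaloisGroup K) → ∀ N, N₀ ≤ N →
        (FramedRep.charpoly (R N) σ).roots =
          (arithFrobPolyOfSatake ι v.residueCard n α).roots.map (· ^ d) +
            (E₂ v 𝔓 φ d σ).map (· * (v.residueCard : PadicAlgCl p) ^ (-(2 * d * (N : ℤ)))) := by
    rintro v ⟨q, hq, hqp, hsplit, hqv, -⟩ α hα 𝔓 h𝔓 φ hφ d hd σ hσ N hN
    exact hRT q hq hqp hsplit v hqv α hα 𝔓 h𝔓 φ hφ d hd σ hσ N hN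
  -- the engine
  obtain ⟨r, hrss, hrF, hrT⟩ := theorem92_engine
    HarrisLanTaylorThorne2016.prop712Hausdorff_holds chebotarev_artinRep_holds
    hasSatakeParamAt_ne_zero_holds p hn0 π.1 ι hSfin hSp hSat hRss (fun v _ ↦ hB v) hRv hTp
    hTsat hE₂ hRT'
  refine ⟨r, hrss, ?_, ?_⟩
  · -- (i) HLTT's Thm. 7.13 at the good places
    intro q hq hqp hQ hπq v hqv α hα
    have hv : v ∉ S := by
      rw [hS_def]
      simp only [Set.mem_setOf_eq, not_not]
      exact ⟨q, hq, hqp, hQ, hπq, hqv⟩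
    exact ⟨(hrF v hv).1, (hrF v hv).2 α hα⟩
  · -- (ii) (9.1) in trace form at the Varma places
    intro q hq hqp hsplit v hqv α hα 𝔓 h𝔓 φ hφ d σ hσ
    have hvT : v ∈ T := ⟨q, hq, hqp, hsplit, hqv, α, hα⟩
    set P : (PadicAlgCl p)[X] := arithFrobPolyOfSatake ι v.residueCard n α with hP
    -- non-zero degrees: the roots of `charpoly r(σ)` are the `b_j^d`
    have hne0 : ∀ d : ℤ, d ≠ 0 → ∀ σ : absoluteGaloisGroup K,
        σ * (φ ^ d)⁻¹ ∈ 𝔓.inertia (absoluteGaloisGroup K) →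
        ((r σ : GL (Fin n) (PadicAlgCl p)) : Matrix (Fin n) (Fin n) (PadicAlgCl p)).trace =
          ((P.roots.map fun b ↦ b ^ d).sum) := by
      intro d hd σ hσ
      rw [Matrix.trace_eq_sum_roots_charpoly]
      exact congrArg Multiset.sum (hrT v hvT α hα 𝔓 h𝔓 φ hφ d hd σ hσ)
    by_cases hd : d = 0
    · subst hd
      -- degree `0`: `σ ∈ I_𝔓`; recurrence with `A = r(φ)`, `B = r(σ)`, `b` = the roots of `P`
      rw [zpow_zero, inv_one, mul_one] at hσ
      have hb0 : (0 : PadicAlgCl p) ∉ P.roots :=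
        zero_not_mem_roots_arithFrobPolyOfSatake ι (lt_trans zero_lt_one v.one_lt_residueCard) n
          (hasSatakeParamAt_ne_zero_holds hα)
      have key := trace_eq_card_of_forall_trace_mul_pow (r φ)
        ((r σ : GL (Fin n) (PadicAlgCl p)) : Matrix (Fin n) (Fin n) (PadicAlgCl p)) P.roots hb0
        (fun k hk ↦ by
          -- `tr (r(σ) r(φ)^k) = tr r(σ φ^k)`, and `(σ φ^k) (φ^k)⁻¹ = σ ∈ I_𝔓`
          have hk0 : (k : ℤ) ≠ 0 := by exact_mod_cast Nat.one_le_iff_ne_zero.mp hk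
          have h' := hne0 (k : ℤ) hk0 (σ * φ ^ (k : ℤ)) (by rwa [mul_inv_cancel_right])
          rw [map_mul, map_zpow, zpow_natCast, Units.val_mul, Units.val_pow_eq_pow_val] at h'
          rw [h']
          exact congrArg Multiset.sum (Multiset.map_congr rfl fun b _ ↦ zpow_natCast b k))
      rw [key, card_roots_arithFrobPolyOfSatake, hα.card_eq]
      rw [Multiset.map_congr rfl (fun b _ ↦ zpow_zero b), Multiset.map_const',
        Multiset.sum_replicate, card_roots_arithFrobPolyOfSatake, hα.card_eq, nsmul_eq_mul,
        mul_one]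
    · exact hne0 d hd σ hσ

end Varma2024

end Literature.NumberTheory.Automorphic

end
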